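import Literature.Analysis.FluidPDE.EulerBlowupScaling
import HarnessLib

/-!
# J. Chen 2024: `C^{1,α}` axisymmetric no-swirl Euler blow-up whose velocity is smooth away from
# ONE point (named fact), and its place above `elgindi_euler_blowup` (proved)

J. Chen, *Remarks on the smoothness of the `C^{1,α}` asymptotically self-similar singularity in
the 3D Euler and 2D Boussinesq equations*, Nonlinearity **37** (2024) no. 6, 065018
= arXiv:2309.00150 [Chen2024OnePointSingularity]; theorem numbers of the arXiv text (held
`paper:arxiv-2309.00150`, chunks p0002–p0006, p0012 opened).

Printed (§1.1 **Theorem 1**, chunk p0004 L6): "There exists `α ∈ (0, 1)` and initial data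
`ω₀^θ ∈ C_c^α ∩ C^∞(ℝ³ ∖ {0})` without swirl, such that the unique local solution to the
axisymmetric 3D Euler equations (eq:euler_axi) develops an asymptotically self-similar
singularity in finite time `T < +∞`. Moreover, for `t < T`, the solution has regularity
`u(t) ∈ C^{1,α} ∩ C^∞(ℝ³ ∖ {0}) ∩ L²`." Abstract (p0002): "the constructions of `C^{1,α}`
asymptotically self-similar singularities for the 3D Euler equations by Elgindi, and for the 3D
Euler equations with large swirl and 2D Boussinesq equations with boundary by Chen–Hou can be
extended to construct singularity with velocity `u ∈ C^{1,α}` that is not smooth at only one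
point." Proof (§2, p0006): a partition-of-unity perturbation `F̃₀` of Elgindi's profile `F`
removing its non-smooth part near `β = 0, π/2` away from `R = 0`, small in EGM's `ℋᵏ` so that the
EGM stability theorem (their Thm 2 = the paper's Thm 4, p0006 L97–L101: "the unique local
solution `u ∈ L² ∩ C^{1,α}` … blows up in finite time") applies, plus a BKM-type continuation
criterion for the `C^∞(ℝ³ ∖ {0})` regularity in weighted Hölder spaces `X_σ^∞` (§3, Prop. 3.1ff).
Theorems 2–3 (Boussinesq in `ℝ²₊`; Euler in the cylinder `{r ≤ 1} × ℝ/2ℤ` with the wall, LARGE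
swirl, non-smoothness only on the ring `O = {(r,z) = (1,0)}`) are the boundary versions.

## Why the cell wants it (ns-blowup D-0081 §A1, zone Z6; ns-lit-coord-1 RULING (g))

Zone Z6 continues Elgindi's no-swirl `C^{1,α}` self-similar blow-up toward smoother data. The two
printed walls are typed elsewhere (no-swirl data with `|ω₀^θ| ≤ c·r`:
`MajdaBertozzi2002_axisymNoSwirlGlobal`, `curl_axisBound_of_contDiff_two`; the `L^{3,1}` / `1/3`
threshold: Danchin 2007, Abidi–Hmidi–Keraani 2010 — harvest-2's file). This file records the
complementary POSITIVE statement in print: the roughness of the Elgindi scenario can be confined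
to the single point where the collapse happens — everywhere else the blowing-up velocity is `C^∞`.
So a Z6 «KEEP» object is not excluded merely for being smooth off the origin, and conversely no
amount of smoothing AWAY from the collapse point changes the census class (the K-block sentence
«roughness at the axis/origin is the whole mechanism» is decl-backed here). NB (lit check, for
the record of STATUS l.4312/l.4343): this paper prints NO "`α > 1/3`" regularity threshold.

## Contents

* `Chen2024_onePointNonsmoothBlowup` — NAMED FACT (net debt +1), Theorem 1 TYPED BY ITS PRINTED
  CONSEQUENCE in the reviewed vocabulary of `elgindi_euler_blowup` (`Axisymmetric.lean`): there
  are `α ∈ (0,1)`, `T > 0` and a classical Euler solution `(u, p)` on `ℝ³ × [0, T)`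
  (`IsClassicalEulerOnDomain (Ico 0 T) ⊤ 0 0 u p`) whose initial vorticity is compactly supported,
  whose slices are `C^{1,α}` (`MemC1Holder α`), of finite energy, axisymmetric WITHOUT swirl and
  `C^∞` on `ℝ³ ∖ {0}` (`ContDiffOn ℝ ∞ (u t) {0}ᶜ`) for every `t < T`, and whose vorticity blows
  up at `T` (`VorticityBlowsUpAt u T`, the Beale–Kato–Majda form). WEAKER than print: the
  asymptotically self-similar structure of the singularity and the uniqueness clause are recorded
  in this docstring, not asserted (same policy as `chenHouHuang2022_houLuo_blowup`).
* PROVED: `Chen2024_onePointNonsmoothBlowup.elgindi_euler_blowup` — the fact implies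
  `elgindi_euler_blowup` (drop the off-origin smoothness and the support clause, rescale the
  blow-up time to `1` by `elgindi_euler_blowup_of_blowupTime`): it is a STRENGTHENING of the
  tree's ns.S29 (i), not a restatement (D-0026 hygiene), and `lt_one` bookkeeping of `α`.

## Rendering notes

* "without swirl" is printed of the datum; the EGM solution it launches stays axisymmetric and
  swirl-free (class preserved by the equations and by the uniqueness in EGM Thm 2 / the paper's
  Thm 4) — included for all `t < T`, exactly as in `elgindi_euler_blowup`.
* `C¹` of `(u, p)` jointly in `(t, x)` is the `IsClassicalEulerOnDomain` reading already reviewed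
  for `elgindi_euler_blowup` (EGM's class `C^{1,α}_{x,t}`, into which the paper's Thm 4 places the
  solution).
* `C^∞(ℝ³ ∖ {0})` of the velocity slice is `ContDiffOn ℝ ∞ (u t) {x | x ≠ 0}` (an open set, so
  this is smoothness in the usual sense at every `x ≠ 0`).

WHAT THIS IS NOT: not Navier–Stokes; not a statement about flows with swirl on `ℝ³` (Thm 3's
swirl needs the wall); nothing here is computed — one printed theorem as a named `Prop`.

## References

* J. Chen, Nonlinearity 37 (2024) 065018, doi:10.1088/1361-6544/ad45a2 = arXiv:2309.00150:
  abstract (p0002), §1.1 Thm 1 (p0004 L6), Thms 2–3 (p0004), §2 Thm 4 and the construction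
  (p0006), §3 Prop. 3.1 (p0012). [`Chen2024OnePointSingularity`]
* T. M. Elgindi, Ann. of Math. 194 (2021) = arXiv:1904.04795, §1.3 Thm 1; T. M. Elgindi,
  T.-E. Ghoul, N. Masmoudi, Camb. J. Math. 9 (2021) = arXiv:1910.14071, Thm 2 (the stability
  theorem used). [`Elgindi2021`, `ElgindiGhoulMasmoudi2021`]
-/

noncomputable section

open MeasureTheory Set Function Filter TopologicalSpace
open _root_.Topology
open scoped ContDiff NNReal ENNReal

namespace Literature.Analysis.FluidPDE

/-! ### The named fact -/

/-- **J. Chen 2024, Theorem 1** (`C^{1,α}` asymptotically self-similar blow-up of axisymmetric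
no-swirl 3D Euler with velocity smooth away from ONE point). Printed: "There exists `α ∈ (0, 1)`
and initial data `ω₀^θ ∈ C_c^α ∩ C^∞(ℝ³ ∖ {0})` without swirl, such that the unique local solution
to the axisymmetric 3D Euler equations develops an asymptotically self-similar singularity in
finite time `T < +∞`. Moreover, for `t < T`, the solution has regularity
`u(t) ∈ C^{1,α} ∩ C^∞(ℝ³ ∖ {0}) ∩ L²`." TYPED by its printed consequence (module docstring):
there are `α ∈ (0,1)`, `T > 0` and a classical solution `(u, p)` of the incompressible Euler
equations (`f = 0`) on `ℝ³ × [0, T)` with compactly supported initial vorticity, whose slices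
`u(t)`, `t < T`, are `C^{1,α}`, of finite energy, axisymmetric without swirl and `C^∞` on
`ℝ³ ∖ {0}`, and whose vorticity blows up at `T` (`limsup_{t ↑ T} ‖ω(t)‖_∞ = ∞`). The
asymptotically self-similar structure and the uniqueness clause are not asserted (weaker than
print). [cite: Chen2024OnePointSingularity, §1.1 Theorem 1 (arXiv:2309.00150 p0004 L6); abstract (p0002); §2 Theorem 4 and proof of Theorem 1 (p0006)] -/
def Chen2024_onePointNonsmoothBlowup : Prop :=
  ∃ α : ℝ≥0, 0 < α ∧ α < 1 ∧ ∃ T : ℝ, 0 < T ∧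
    ∃ (u : ℝ → EuclideanSpace ℝ (Fin 3) → EuclideanSpace ℝ (Fin 3))
      (p : ℝ → EuclideanSpace ℝ (Fin 3) → ℝ),
      FluidPDE.IsClassicalEulerOnDomain (Ico 0 T) (⊤ : Opens (EuclideanSpace ℝ (Fin 3))) 0 0 u p ∧
      HasCompactSupport (curl (u 0)) ∧
      (∀ t ∈ Ico 0 T, FluidPDE.MemC1Holder α (u t) ∧ FluidPDE.HasFiniteEnergy (u t) ∧
        FluidPDE.IsAxisymmetric (u t) ∧ FluidPDE.HasNoSwirl (u t) ∧
        ContDiffOn ℝ ∞ (u t) {x | x ≠ 0}) ∧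
      FluidPDE.VorticityBlowsUpAt u T

/-! ### Proved: the fact sits above `elgindi_euler_blowup` -/

/-- **J. Chen's Theorem 1 implies the tree's ns.S29 (i)** `elgindi_euler_blowup`
(Elgindi–Ghoul–Masmoudi Thm 1 in its reviewed rendering): forget the smoothness away from the
origin and the support clause, and rescale the blow-up time `T` to `1`
(`elgindi_euler_blowup_of_blowupTime`). So the new fact is a strengthening of the old one, not a
paraphrase. [cite: Chen2024OnePointSingularity, abstract (arXiv:2309.00150 p0002): "can be extended to construct singularity with velocity u ∈ C^{1,α} that is not smooth at only one point"] -/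
theorem Chen2024_onePointNonsmoothBlowup.elgindi_euler_blowup
    (h : Chen2024_onePointNonsmoothBlowup) : elgindi_euler_blowup := by
  obtain ⟨α, hα, -, T, hT, u, p, hsol, -, hslice, hblow⟩ := h
  exact elgindi_euler_blowup_of_blowupTime hT
    ⟨α, hα, u, p, hsol, fun t ht =>
      ⟨(hslice t ht).1, (hslice t ht).2.1, (hslice t ht).2.2.1, (hslice t ht).2.2.2.1⟩, hblow⟩

/-- Under the fact, the blowing-up velocity slices are smooth at every point other than the
origin — the printed point of the paper ("not smooth at only one point"), isolated as the clause a
consumer cites. [cite: Chen2024OnePointSingularity, §1.1 Theorem 1 (arXiv:2309.00150 p0004 L6)] -/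
theorem Chen2024_onePointNonsmoothBlowup.exists_smooth_off_origin
    (h : Chen2024_onePointNonsmoothBlowup) :
    ∃ α : ℝ≥0, 0 < α ∧ α < 1 ∧ ∃ T : ℝ, 0 < T ∧
      ∃ (u : ℝ → EuclideanSpace ℝ (Fin 3) → EuclideanSpace ℝ (Fin 3)),
        FluidPDE.VorticityBlowsUpAt u T ∧
        ∀ t ∈ Ico 0 T, ∀ x : EuclideanSpace ℝ (Fin 3), x ≠ 0 → ContDiffAt ℝ ∞ (u t) x := by
  obtain ⟨α, hα, hα1, T, hT, u, p, -, -, hslice, hblow⟩ := h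
  refine ⟨α, hα, hα1, T, hT, u, hblow, fun t ht x hx => ?_⟩
  exact ((hslice t ht).2.2.2.2).contDiffAt (isOpen_ne.mem_nhds hx)

end Literature.Analysis.FluidPDE

end
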